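import Summits.CriticalPhenomena.CardyFormulaZ2.Theorems.HalfPlaneMarkDensityLaw.Negative.MarkEvents
import Literature.Probability.Percolation.HalfPlaneOneArmQuasiMultiplicativity
import Literature.Probability.Percolation.HalfPlaneArmAxisInputs
import HarnessLib

/-!
# Line `Sketch` — crux 5 ⟹ crux 6, lattice stub: the half-annulus block crossing is antitone in the
# window (crux stmt-CriticalPhenomena-5661, lead c10-0)

In the axis coordinates `X v = v 0`, `Y v = v 1` of bond-`ℤ²` with base point `0`, write
`ν v = max |v 0 - 0| (v 1 - 0)` for the half-plane norm, `ann₀[r, R] = {0 ≤ v 1 ∧ r ≤ ν v ∧ ν v ≤ R}`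
for the upper half-annulus and `E₀[r, R] = openCrossing ann₀[r, R] {ν = r} {ν = R}` for its block
crossing event.

* `stub_blockAnti`: for `r' ≤ r ≤ R ≤ R'`, `P_{1/2}(E₀[r', R']) ≤ P_{1/2}(E₀[r, R])` — on a lattice
  configuration an open crossing of the wider half-annulus, clipped to the window `r ≤ ν ≤ R` of the
  `1`-Lipschitz norm (`exists_openConnIn_clip`), is an open crossing of the narrower one; then
  monotonicity of the measure (`P_{1/2}` is carried by lattice configurations).
-/

noncomputable section

namespace Summit.CriticalPhenomena.CardyFormulaZ2.Cruxes.HalfPlaneMarkDensityLaw.SketchLine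

open Literature.Probability.Percolation Literature.Probability.LatticeModels
open MeasureTheory Filter Set
open scoped Topology
open Summit.CriticalPhenomena.CardyFormulaZ2.Theorems.HalfPlaneMarkDensityLaw.Negative

namespace OneArm

/-- **Deterministic inclusion.** On a lattice configuration `ω ⊆ E(ℤ²)`, an open crossing of the
wider upper half-annulus `ann₀[r', R']` between its two rims contains an open crossing of the
narrower one `ann₀[r, R]`, `r' ≤ r ≤ R ≤ R'` (clip the path to the window `r ≤ ν ≤ R` of the
`1`-Lipschitz half-plane norm `ν`). [folklore] -/
private theorem stub_blockAnti_aux_mem {ω : BondConfig (Site 2)} (hω : ω ⊆ (zdGraph 2).edgeSet)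
    {r' r R R' : ℤ} (h1 : r' ≤ r) (h2 : r ≤ R) (h3 : R ≤ R')
    (h : ω ∈ openCrossing
      {v : Site 2 | 0 ≤ v 1 ∧ r' ≤ max |v 0 - (0 : Site 2) 0| (v 1 - (0 : Site 2) 1) ∧
        max |v 0 - (0 : Site 2) 0| (v 1 - (0 : Site 2) 1) ≤ R'}
      {v : Site 2 | max |v 0 - (0 : Site 2) 0| (v 1 - (0 : Site 2) 1) = r'}
      {v : Site 2 | max |v 0 - (0 : Site 2) 0| (v 1 - (0 : Site 2) 1) = R'}) :
    ω ∈ openCrossing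
      {v : Site 2 | 0 ≤ v 1 ∧ r ≤ max |v 0 - (0 : Site 2) 0| (v 1 - (0 : Site 2) 1) ∧
        max |v 0 - (0 : Site 2) 0| (v 1 - (0 : Site 2) 1) ≤ R}
      {v : Site 2 | max |v 0 - (0 : Site 2) 0| (v 1 - (0 : Site 2) 1) = r}
      {v : Site 2 | max |v 0 - (0 : Site 2) 0| (v 1 - (0 : Site 2) 1) = R} := by
  obtain ⟨x, hx, y, hy, hxy⟩ := h
  have hx : max |x 0 - (0 : Site 2) 0| (x 1 - (0 : Site 2) 1) = r' := hx
  have hy : max |y 0 - (0 : Site 2) 0| (y 1 - (0 : Site 2) 1) = R' := hy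
  obtain ⟨x', y', hx', hy', hconn⟩ := exists_openConnIn_clip hω
    (fun v : Site 2 => max |v 0 - (0 : Site 2) 0| (v 1 - (0 : Site 2) 1))
    (HalfPlaneArm.norm_le_of_adj (X := fun v : Site 2 => v 0) (Y := fun v : Site 2 => v 1)
      HalfPlaneArm.axis_X_le HalfPlaneArm.axis_Y_le 0)
    (a := r) (b := R) h2 (hx.le.trans h1) (h3.trans hy.ge) hxy
  refine ⟨x', hx', y', hy', openConnIn_mono ?_ _ _ hconn⟩
  exact fun v hv => ⟨hv.1.1, hv.2.1, hv.2.2⟩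

/-- STUB (lattice) `stub_blockAnti`: the block crossing probability of the upper half-annulus is
antitone in the window: for `r' ≤ r ≤ R ≤ R'`, `P_{1/2}(E₀[r', R']) ≤ P_{1/2}(E₀[r, R])`
(a crossing of the wider half-annulus contains a crossing of the narrower one). [folklore] -/
theorem stub_blockAnti : ∀ r' r R R' : ℤ, r' ≤ r → r ≤ R → R ≤ R' → μ.real (openCrossing {v : Site 2 | 0 ≤ v 1 ∧ r' ≤ max |v 0 - (0 : Site 2) 0| (v 1 - (0 : Site 2) 1) ∧ max |v 0 - (0 : Site 2) 0| (v 1 - (0 : Site 2) 1) ≤ R'} {v : Site 2 | max |v 0 - (0 : Site 2) 0| (v 1 - (0 : Site 2) 1) = r'} {v : Site 2 | max |v 0 - (0 : Site 2) 0| (v 1 - (0 : Site 2) 1) = R'}) ≤ μ.real (openCrossing {v : Site 2 | 0 ≤ v 1 ∧ r ≤ max |v 0 - (0 : Site 2) 0| (v 1 - (0 : Site 2) 1) ∧ max |v 0 - (0 : Site 2) 0| (v 1 - (0 : Site 2) 1) ≤ R} {v : Site 2 | max |v 0 - (0 : Site 2) 0| (v 1 - (0 : Site 2) 1) = r} {v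 : Site 2 | max |v 0 - (0 : Site 2) 0| (v 1 - (0 : Site 2) 1) = R}) := by
  intro r' r R R' h1 h2 h3
  simp only [μ]
  refine ENNReal.toReal_mono (measure_ne_top _ _) (measure_mono_ae ?_)
  filter_upwards [ae_subset_edgeSet (zdGraph 2) half] with ω hω h
  exact stub_blockAnti_aux_mem hω h1 h2 h3 h

end OneArm

end Summit.CriticalPhenomena.CardyFormulaZ2.Cruxes.HalfPlaneMarkDensityLaw.SketchLine

end
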